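import Mathlib
import Summits.AtomisticToContinuum.HydrodynamicLimit.Theorems.InformationPercolationEngineKickFairRelEquilibriumMesoDefs
import Literature.MathematicalPhysics.KineticTheory.HardSphereEulerProofs
import HarnessLib

/-!
# `InformationPercolationEngine.KickFairRelEquilibriumMeso` (stmt-AtomisticToContinuum-15177):
# S0′ — oscillation of `log (dLG/dG)` over a level set of the time-zero key

Helper file (`--supports stmt-AtomisticToContinuum-15177`) of the line `Sketch` (card
`two-time-pinch`): the registered stub `stub_binOscillation` (= `BinOscillation` of the line's
vocabulary file `…KickFairRelEquilibriumMesoDefs`, registered signature verbatim). For continuous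
positive profiles and `η > 0`, eventually in `N`, configurations `z, z'` with the same binned
time-zero cell data `cellKey (rs N) (rs N)` satisfy `f(z) f₁(z') ≤ exp(η((N+1) + KE z + KE z'))
f(z') f₁(z)` for the canonical densities `f, f₁` of the local Gibbs law and of the invariant law.

Proof. Both densities are `Z⁻¹ · 1_D · ∏ᵢ profile(zᵢ)`: off the hard-sphere domain the left side
vanishes, on it partition functions and indicators are common nonnegative factors. The profiles
satisfy `f_{a₀,u₀,θ₀}(x,v) = exp(ψ(x,v)) f_{1,0,1}(x,v)` with the AFFINE tilt
`ψ(x,v) = α(x) + β(x)‖v‖² + ⟨γ(x), v⟩` (`α = log a₀ − (3/2) log θ₀ − ‖u₀‖²/(2θ₀)`,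
`β = 1/2 − 1/(2θ₀)`, `γ = u₀/θ₀`, continuous on the compact torus), and the tilt sums of `z, z'`
are compared cell by cell (`sum_le_of_cellKey_eq`): positions are replaced by a reference point of
their `rs N`-cell at the price of a modulus of continuity times `1 + ‖v‖²` per particle; the
cell-centred sum `∑ₖ [nₖ α(x̄ₖ) + β(x̄ₖ) Eₖ + ⟨γ(x̄ₖ), Pₖ⟩]` changes by
`≤ (sup|β| + 2 sup‖γ‖) rs N` per occupied cell when counts agree and energies and momenta lie in
common bins of width `rs N`; there are `≤ 2(N+1)` occupied cells and `rs N → 0`. Mathlib only.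
-/

noncomputable section

open MeasureTheory Set Filter Topology
open scoped ENNReal Classical InnerProductSpace

namespace Summit.AtomisticToContinuum.HydrodynamicLimit.Theorems.KickFairRelEquilibriumMesoLine

open Literature.Analysis.FluidPDE Literature.MathematicalPhysics.KineticTheory

namespace BinOscillation

/-! ## Elementary facts: bins of width `w`, cells of mesh `r` -/

/-- Two reals in the same bin of width `w > 0` differ by less than `w`:
`⌊a/w⌋ = ⌊b/w⌋ → |a - b| < w`. -/
theorem abs_sub_lt_of_floor_div_eq {a b w : ℝ} (hw : 0 < w) (h : ⌊a / w⌋ = ⌊b / w⌋) :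
    |a - b| < w := by
  have h1 : |a / w - b / w| < 1 := Int.abs_sub_lt_one_of_floor_eq_floor h
  rw [← sub_div, abs_div, abs_of_pos hw, div_lt_one hw] at h1
  exact h1

/-- Two points of `𝕋³` in the same `r`-cell of `Torus.coarseCell r` are at (sup-)distance `< r`:
every coordinate of their symmetric representatives lies in the same bin of width `r`, and the
quotient norm of `ℝ/ℤ` is dominated by the absolute value of any lift. -/
theorem dist_lt_of_coarseCell_eq {r : ℝ} (hr : 0 < r) {x y : T3}
    (h : Torus.coarseCell r x = Torus.coarseCell r y) : dist x y < r := by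
  rw [dist_eq_norm, pi_norm_lt_iff hr]
  intro i
  have hi : ⌊Torus.reprSym x i / r⌋ = ⌊Torus.reprSym y i / r⌋ := congr_fun h i
  have h1 := abs_sub_lt_of_floor_div_eq hr hi
  have hx : ((Torus.reprSym x i : ℝ) : UnitAddCircle) = x i := congr_fun (Torus.proj_reprSym x) i
  have hy : ((Torus.reprSym y i : ℝ) : UnitAddCircle) = y i := congr_fun (Torus.proj_reprSym y) i
  rw [Pi.sub_apply, ← hx, ← hy, ← AddCircle.coe_sub]
  exact (QuotientAddGroup.norm_mk_le_norm).trans_lt (by simpa [Real.norm_eq_abs] using h1)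

/-- **Cell representatives.** There is a choice of one reference point per `r`-cell such that every
point of `𝕋³` is at distance `< r` from the reference point of its cell. -/
theorem exists_cellRep {r : ℝ} (hr : 0 < r) :
    ∃ rep : (Fin 3 → ℤ) → T3, ∀ x : T3, dist x (rep (Torus.coarseCell r x)) < r := by
  refine ⟨fun k => if h : ∃ y : T3, Torus.coarseCell r y = k then h.choose else 0, fun x => ?_⟩
  have hex : ∃ y : T3, Torus.coarseCell r y = Torus.coarseCell r x := ⟨x, rfl⟩
  simp only [dif_pos hex]
  exact dist_lt_of_coarseCell_eq hr hex.choose_spec.symm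

/-- Summing an affine function of `(‖v‖², v)` over a finite family of velocities:
`∑ (a + b ‖vᵢ‖² + ⟨c, vᵢ⟩) = |s| a + b ∑ ‖vᵢ‖² + ⟨c, ∑ vᵢ⟩`. -/
theorem sum_affine {ι : Type*} (a b : ℝ) (c : V3) (s : Finset ι) (v : ι → V3) :
    ∑ i ∈ s, (a + b * ‖v i‖ ^ 2 + ⟪c, v i⟫_ℝ) =
      (s.card : ℝ) * a + b * ∑ i ∈ s, ‖v i‖ ^ 2 + ⟪c, ∑ i ∈ s, v i⟫_ℝ := by
  rw [Finset.sum_add_distrib, Finset.sum_add_distrib, Finset.sum_const, nsmul_eq_mul,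
    ← Finset.mul_sum, inner_sum]

/-- A vector of `ℝ³` all of whose coordinates have absolute value `< r` has norm `≤ 2 r`
(`‖w‖² = ∑ wⱼ² ≤ 3 r² ≤ 4 r²`). -/
theorem norm_le_two_mul_of_forall_abs_lt {r : ℝ} (hr : 0 < r) {w : V3} (h : ∀ j, |w j| < r) :
    ‖w‖ ≤ 2 * r := by
  have hsq : ‖w‖ ^ 2 ≤ (2 * r) ^ 2 := by
    rw [EuclideanSpace.real_norm_sq_eq]
    calc ∑ j, w j ^ 2 ≤ ∑ _j : Fin 3, r ^ 2 := Finset.sum_le_sum fun j _ => by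
            rw [← sq_abs]; exact pow_le_pow_left₀ (abs_nonneg _) (h j).le 2
      _ = 3 * r ^ 2 := by simp
      _ ≤ (2 * r) ^ 2 := by nlinarith
  exact le_of_pow_le_pow_left₀ two_ne_zero (by positivity) hsq

/-! ## The core estimate -/

/-- **Core estimate.** For continuous `α, β : 𝕋³ → ℝ`, `γ : 𝕋³ → ℝ³` and `η > 0`, eventually
in `N`, two configurations `z, z'` with the same key `cellKey (rs N) (rs N)` satisfy
`∑ᵢ ψ(zᵢ) ≤ η ((N+1) + KE z + KE z') + ∑ᵢ ψ(z'ᵢ)` for `ψ(x, v) = α(x) + β(x) ‖v‖² + ⟨γ(x), v⟩`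
(cell representatives + uniform continuity; per occupied cell the cell-centred sum
`nₖ α(x̄ₖ) + β(x̄ₖ) Eₖ + ⟨γ(x̄ₖ), Pₖ⟩` moves by `≤ (sup |β| + 2 sup ‖γ‖) rs N`; `rs N → 0`). -/
theorem sum_le_of_cellKey_eq {α β : T3 → ℝ} {γ : T3 → V3} (hα : Continuous α)
    (hβ : Continuous β) (hγ : Continuous γ) {η : ℝ} (hη : 0 < η) :
    ∃ N₀ : ℕ, ∀ N : ℕ, N₀ ≤ N → ∀ z z' : Phase N,
      cellKey (rs N) (rs N) z = cellKey (rs N) (rs N) z' →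
      ∑ i, (α (z i).1 + β (z i).1 * ‖(z i).2‖ ^ 2 + ⟪γ (z i).1, (z i).2⟫_ℝ) ≤
        η * (((N : ℝ) + 1) + kinEnergy z + kinEnergy z') +
          ∑ i, (α (z' i).1 + β (z' i).1 * ‖(z' i).2‖ ^ 2 + ⟪γ (z' i).1, (z' i).2⟫_ℝ) := by
  -- global bounds on `β`, `γ`
  obtain ⟨B, hB⟩ : ∃ B, ∀ x, |β x| ≤ B := by
    obtain ⟨C, hC⟩ := isCompact_univ.exists_bound_of_continuousOn hβ.continuousOn
    exact ⟨C, fun x => by simpa [Real.norm_eq_abs] using hC x (mem_univ x)⟩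
  obtain ⟨Γ, hΓ⟩ : ∃ Γ, ∀ x, ‖γ x‖ ≤ Γ := by
    obtain ⟨C, hC⟩ := isCompact_univ.exists_bound_of_continuousOn hγ.continuousOn
    exact ⟨C, fun x => hC x (mem_univ x)⟩
  have hB0 : 0 ≤ B := (abs_nonneg _).trans (hB 0)
  have hΓ0 : 0 ≤ Γ := (norm_nonneg _).trans (hΓ 0)
  -- uniform continuity at precision `ε = η / 8`
  obtain ⟨ε, hε, hεη⟩ : ∃ ε : ℝ, 0 < ε ∧ 8 * ε = η := ⟨η / 8, by positivity, by ring⟩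
  obtain ⟨ρ, hρ, hρα, hρβ, hργ⟩ : ∃ ρ : ℝ, 0 < ρ ∧ (∀ x y, dist x y < ρ → |α x - α y| < ε) ∧
      (∀ x y, dist x y < ρ → |β x - β y| < ε) ∧ (∀ x y, dist x y < ρ → ‖γ x - γ y‖ < ε) := by
    obtain ⟨ρ₁, hρ₁, h₁⟩ := Metric.uniformContinuous_iff.1
      (CompactSpace.uniformContinuous_of_continuous hα) ε hε
    obtain ⟨ρ₂, hρ₂, h₂⟩ := Metric.uniformContinuous_iff.1
      (CompactSpace.uniformContinuous_of_continuous hβ) ε hε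
    obtain ⟨ρ₃, hρ₃, h₃⟩ := Metric.uniformContinuous_iff.1
      (CompactSpace.uniformContinuous_of_continuous hγ) ε hε
    refine ⟨min ρ₁ (min ρ₂ ρ₃), lt_min hρ₁ (lt_min hρ₂ hρ₃), fun x y h => ?_, fun x y h => ?_,
      fun x y h => ?_⟩
    · simpa [Real.dist_eq] using h₁ (h.trans_le (min_le_left _ _))
    · simpa [Real.dist_eq] using h₂ (h.trans_le ((min_le_right _ _).trans (min_le_left _ _)))
    · simpa [dist_eq_norm] using h₃ (h.trans_le ((min_le_right _ _).trans (min_le_right _ _)))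
  -- eventually the mesh is finer than `ρ` and the per-cell bill is `≤ η / 4` per particle
  have hev : ∀ᶠ N in atTop, rs N < ρ ∧ 2 * (B + 2 * Γ) * rs N ≤ η / 2 := by
    refine (tendsto_rs.eventually (gt_mem_nhds hρ)).and ?_
    have h := tendsto_rs.const_mul (2 * (B + 2 * Γ))
    rw [mul_zero] at h
    exact h.eventually (ge_mem_nhds (by positivity))
  obtain ⟨N₀, hN₀⟩ := eventually_atTop.1 hev
  refine ⟨N₀, fun N hN z z' hkey => ?_⟩
  obtain ⟨hrρ, hrη⟩ := hN₀ N hN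
  set r := rs N with hr_def
  have hr : 0 < r := rs_pos N
  -- the one-body tilt and the cell representatives
  set ψ : T3 → V3 → ℝ := fun x v => α x + β x * ‖v‖ ^ 2 + ⟪γ x, v⟫_ℝ with hψ
  show ∑ i, ψ (z i).1 (z i).2 ≤ _ + ∑ i, ψ (z' i).1 (z' i).2
  obtain ⟨rep, hrep⟩ := exists_cellRep hr
  -- (1) the cell-centred tilt is close to the true tilt
  have hA : ∀ (x : T3) (v : V3),
      |ψ x v - ψ (rep (Torus.coarseCell r x)) v| ≤ 2 * ε * (1 + ‖v‖ ^ 2) := by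
    intro x v
    set y := rep (Torus.coarseCell r x) with hy
    have hd : dist x y < ρ := (hrep x).trans hrρ
    have h1 := abs_lt.1 (hρα _ _ hd)
    have h2 := hρβ _ _ hd
    have h3 := hργ _ _ hd
    have hv : ‖v‖ ≤ 1 + ‖v‖ ^ 2 := by nlinarith [norm_nonneg v]
    have key : ψ x v - ψ y v = (α x - α y) + (β x - β y) * ‖v‖ ^ 2 + ⟪γ x - γ y, v⟫_ℝ := by
      simp only [hψ, inner_sub_left]; ring
    have h4 := abs_le.1 (((abs_real_inner_le_norm (γ x - γ y) v)).trans
      (mul_le_mul_of_nonneg_right h3.le (norm_nonneg _)))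
    have h5 : |(β x - β y) * ‖v‖ ^ 2| ≤ ε * ‖v‖ ^ 2 := by
      rw [abs_mul, abs_of_nonneg (by positivity : (0 : ℝ) ≤ ‖v‖ ^ 2)]
      exact mul_le_mul_of_nonneg_right h2.le (by positivity)
    have h5' := abs_le.1 h5
    have h6 : ε * ‖v‖ ≤ ε * (1 + ‖v‖ ^ 2) := mul_le_mul_of_nonneg_left hv hε.le
    rw [key, abs_le]
    constructor <;> nlinarith [h1.1, h1.2, h4.1, h4.2, h5'.1, h5'.2, h6, hε.le,
      sq_nonneg ‖v‖]
  -- summing (1) over the particles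
  have hA' : ∀ w : Phase N,
      |∑ i, ψ (w i).1 (w i).2 - ∑ i, ψ (rep (Torus.coarseCell r (w i).1)) (w i).2| ≤
        2 * ε * (((N : ℝ) + 1) + kinEnergy w) := by
    intro w
    rw [← Finset.sum_sub_distrib]
    refine (Finset.abs_sum_le_sum_abs _ _).trans ?_
    refine (Finset.sum_le_sum fun i _ => hA (w i).1 (w i).2).trans (le_of_eq ?_)
    rw [← Finset.mul_sum, Finset.sum_add_distrib, Finset.sum_const, Finset.card_univ,
      Fintype.card_fin, nsmul_eq_mul, mul_one, kinEnergy]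
    push_cast; ring
  -- (2) the occupied cells
  set t : Finset (Fin 3 → ℤ) :=
    Finset.univ.image (fun i => Torus.coarseCell r (z i).1) ∪
      Finset.univ.image (fun i => Torus.coarseCell r (z' i).1) with ht
  have htcard : (t.card : ℝ) ≤ 2 * ((N : ℝ) + 1) := by
    have h1 : t.card ≤ (N + 1) + (N + 1) := by
      refine (Finset.card_union_le _ _).trans (add_le_add ?_ ?_) <;>
        exact Finset.card_image_le.trans (by simp)
    calc (t.card : ℝ) ≤ (((N + 1) + (N + 1) : ℕ) : ℝ) := by exact_mod_cast h1
      _ = 2 * ((N : ℝ) + 1) := by push_cast; ring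
  have hz_t : ∀ i, Torus.coarseCell r (z i).1 ∈ t := fun i =>
    Finset.mem_union_left _ (Finset.mem_image_of_mem _ (Finset.mem_univ i))
  have hz'_t : ∀ i, Torus.coarseCell r (z' i).1 ∈ t := fun i =>
    Finset.mem_union_right _ (Finset.mem_image_of_mem _ (Finset.mem_univ i))
  -- (3) the cell data: particles, momentum, twice the kinetic energy of a cell
  set I : Phase N → (Fin 3 → ℤ) → Finset (Fin (N + 1)) :=
    fun w k => Finset.univ.filter fun i => Torus.coarseCell r (w i).1 = k with hI
  set P : Phase N → (Fin 3 → ℤ) → V3 := fun w k => ∑ i ∈ I w k, (w i).2 with hP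
  set En : Phase N → (Fin 3 → ℤ) → ℝ := fun w k => ∑ i ∈ I w k, ‖(w i).2‖ ^ 2 with hEn
  have hk : ∀ k, (I z k).card = (I z' k).card ∧ (∀ j, ⌊P z k j / r⌋ = ⌊P z' k j / r⌋) ∧
      ⌊En z k / r⌋ = ⌊En z' k / r⌋ := by
    intro k
    have h : ((I z k).card, (fun j => ⌊P z k j / r⌋), ⌊En z k / r⌋) =
        ((I z' k).card, (fun j => ⌊P z' k j / r⌋), ⌊En z' k / r⌋) := congr_fun hkey k
    simp only [Prod.mk.injEq] at h
    exact ⟨h.1, fun j => congr_fun h.2.1 j, h.2.2⟩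
  -- the cell-centred sums, cell by cell
  have hdecomp : ∀ w : Phase N, (∀ i, Torus.coarseCell r (w i).1 ∈ t) →
      ∑ i, ψ (rep (Torus.coarseCell r (w i).1)) (w i).2 =
        ∑ k ∈ t, (((I w k).card : ℝ) * α (rep k) + β (rep k) * En w k + ⟪γ (rep k), P w k⟫_ℝ) := by
    intro w hw
    rw [← Finset.sum_fiberwise_of_maps_to (s := Finset.univ) (t := t)
      (g := fun i => Torus.coarseCell r (w i).1) (fun i _ => hw i)]
    refine Finset.sum_congr rfl fun k _ => ?_
    have hcongr : ∀ i ∈ Finset.univ.filter (fun i => Torus.coarseCell r (w i).1 = k),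
        ψ (rep (Torus.coarseCell r (w i).1)) (w i).2 = ψ (rep k) (w i).2 := by
      intro i hi
      rw [(Finset.mem_filter.1 hi).2]
    rw [Finset.sum_congr rfl hcongr]
    simp only [hψ]
    rw [sum_affine]
  -- (4) the per-cell bill
  have hcell : ∀ k : Fin 3 → ℤ,
      ((I z k).card : ℝ) * α (rep k) + β (rep k) * En z k + ⟪γ (rep k), P z k⟫_ℝ ≤
        (((I z' k).card : ℝ) * α (rep k) + β (rep k) * En z' k + ⟪γ (rep k), P z' k⟫_ℝ) +
          (B + 2 * Γ) * r := by
    intro k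
    obtain ⟨hn, hPk, hEk⟩ := hk k
    have hE' : |En z k - En z' k| < r := abs_sub_lt_of_floor_div_eq hr hEk
    have hP' : ‖P z k - P z' k‖ ≤ 2 * r := by
      refine norm_le_two_mul_of_forall_abs_lt hr fun j => ?_
      rw [PiLp.sub_apply]
      exact abs_sub_lt_of_floor_div_eq hr (hPk j)
    have h1 : β (rep k) * En z k - β (rep k) * En z' k ≤ B * r := by
      rw [← mul_sub]
      refine (le_abs_self _).trans ?_
      rw [abs_mul]
      exact mul_le_mul (hB _) hE'.le (abs_nonneg _) hB0
    have h2 : ⟪γ (rep k), P z k⟫_ℝ - ⟪γ (rep k), P z' k⟫_ℝ ≤ Γ * (2 * r) := by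
      rw [← inner_sub_right]
      refine (le_abs_self _).trans ((abs_real_inner_le_norm _ _).trans ?_)
      exact mul_le_mul (hΓ _) hP' (norm_nonneg _) hΓ0
    rw [hn]
    linarith
  -- (5) summing (4) over the occupied cells
  have hsumcell :
      ∑ i, ψ (rep (Torus.coarseCell r (z i).1)) (z i).2 ≤
        ∑ i, ψ (rep (Torus.coarseCell r (z' i).1)) (z' i).2 +
          2 * ((N : ℝ) + 1) * ((B + 2 * Γ) * r) := by
    rw [hdecomp z hz_t, hdecomp z' hz'_t]
    refine (Finset.sum_le_sum fun k _ => hcell k).trans ?_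
    rw [Finset.sum_add_distrib, Finset.sum_const, nsmul_eq_mul]
    have h0 : 0 ≤ (B + 2 * Γ) * r := by positivity
    gcongr
  -- (6) assembling
  have hAz := abs_le.1 (hA' z)
  have hAz' := abs_le.1 (hA' z')
  have hKz : 0 ≤ kinEnergy z := Finset.sum_nonneg fun i _ => by positivity
  have hKz' : 0 ≤ kinEnergy z' := Finset.sum_nonneg fun i _ => by positivity
  have hN1 : (0 : ℝ) ≤ (N : ℝ) + 1 := by positivity
  have hbill : 2 * (B + 2 * Γ) * r * ((N : ℝ) + 1) ≤ η / 2 * ((N : ℝ) + 1) :=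
    mul_le_mul_of_nonneg_right hrη hN1
  nlinarith [hAz.1, hAz.2, hAz'.1, hAz'.2, hsumcell, hbill, hKz, hKz', hN1, hε.le, hεη]

/-! ## The log-tilt of the local Gibbs profile against the global one -/

/-- **The local Gibbs profile is an affine exponential tilt of the global one.** For
`a₀(x), θ₀(x) > 0`, `f_{a₀,u₀,θ₀}(x,v) = exp (α(x) + β(x) ‖v‖² + ⟨γ(x), v⟩) f_{1,0,1}(x,v)` with
`α = log a₀ - (3/2) log θ₀ - ‖u₀‖²/(2θ₀)`, `β = 1/2 - 1/(2θ₀)`, `γ = u₀/θ₀` (expand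
`‖v - u₀‖² = ‖v‖² - 2⟨v, u₀⟩ + ‖u₀‖²`; the velocity part is `maxwellian_logTilt_eq` of the crux
workfile, one particle at a time). -/
theorem localGibbsProfile_eq_exp_mul {a₀ θ₀ : T3 → ℝ} {u₀ : T3 → V3}
    (ha0 : ∀ x, 0 < a₀ x) (hθ0 : ∀ x, 0 < θ₀ x) (y : T3 × V3) :
    localGibbsProfile a₀ u₀ θ₀ y =
      Real.exp ((Real.log (a₀ y.1) + Real.log (θ₀ y.1) * (-(Module.finrank ℝ V3 : ℝ) / 2) -
            ‖u₀ y.1‖ ^ 2 / (2 * θ₀ y.1)) +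
          (1 / 2 - 1 / (2 * θ₀ y.1)) * ‖y.2‖ ^ 2 + ⟪(θ₀ y.1)⁻¹ • u₀ y.1, y.2⟫_ℝ) *
        localGibbsProfile (fun _ => 1) (fun _ => 0) (fun _ => 1) y := by
  obtain ⟨x, v⟩ := y
  have ha := ha0 x
  have hθ := hθ0 x
  set p : ℝ := -(Module.finrank ℝ V3 : ℝ) / 2 with hp
  have h3 : (2 * Real.pi * θ₀ x) ^ p = (2 * Real.pi) ^ p * θ₀ x ^ p :=
    Real.mul_rpow (by positivity) hθ.le
  have hexp : Real.log (a₀ x) + Real.log (θ₀ x) * p + -‖v - u₀ x‖ ^ 2 / (2 * θ₀ x) =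
      ((Real.log (a₀ x) + Real.log (θ₀ x) * p - ‖u₀ x‖ ^ 2 / (2 * θ₀ x)) +
          (1 / 2 - 1 / (2 * θ₀ x)) * ‖v‖ ^ 2 + ⟪(θ₀ x)⁻¹ • u₀ x, v⟫_ℝ) + -‖v‖ ^ 2 / 2 := by
    simp only [norm_sub_sq_real, inner_smul_left, real_inner_comm]
    simp only [RCLike.conj_to_real]
    field_simp
    ring
  calc localGibbsProfile a₀ u₀ θ₀ (x, v)
      = a₀ x * (1 * (2 * Real.pi * θ₀ x) ^ p * Real.exp (-‖v - u₀ x‖ ^ 2 / (2 * θ₀ x))) := rfl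
    _ = (2 * Real.pi) ^ p * (Real.exp (Real.log (a₀ x)) * Real.exp (Real.log (θ₀ x) * p) *
          Real.exp (-‖v - u₀ x‖ ^ 2 / (2 * θ₀ x))) := by
        rw [h3, ← Real.rpow_def_of_pos hθ, Real.exp_log ha]; ring
    _ = (2 * Real.pi) ^ p *
          Real.exp (((Real.log (a₀ x) + Real.log (θ₀ x) * p - ‖u₀ x‖ ^ 2 / (2 * θ₀ x)) +
            (1 / 2 - 1 / (2 * θ₀ x)) * ‖v‖ ^ 2 + ⟪(θ₀ x)⁻¹ • u₀ x, v⟫_ℝ) + -‖v‖ ^ 2 / 2) := by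
        rw [← Real.exp_add, ← Real.exp_add, hexp]
    _ = _ := by
        rw [Real.exp_add]
        simp only [localGibbsProfile, localMaxwellian, one_mul, mul_one, sub_zero, ← hp]
        ring

/-- The four-term rearrangement: `x ≤ e x'` and `a, b, j, j' ≥ 0` give
`a (x j) (b j') ≤ e (a (x' j') (b j))`. -/
theorem mul_mul_le_of_le {a b j j' x x' e : ℝ} (ha : 0 ≤ a) (hb : 0 ≤ b) (hj : 0 ≤ j)
    (hj' : 0 ≤ j') (h : x ≤ e * x') : a * (x * j) * (b * j') ≤ e * (a * (x' * j') * (b * j)) :=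
  calc a * (x * j) * (b * j') = a * b * (j * j') * x := by ring
    _ ≤ a * b * (j * j') * (e * x') :=
      mul_le_mul_of_nonneg_left h (mul_nonneg (mul_nonneg ha hb) (mul_nonneg hj hj'))
    _ = _ := by ring

end BinOscillation

open BinOscillation in
/-- **S0′ — oscillation of `log (dLG/dG)` over a level set of the time-zero key** (registered stub
`stub_binOscillation` of the line `Sketch` = `BinOscillation` of the Defs file): eventually in `N`,
`f(z) f₁(z') ≤ exp (η ((N+1) + KE z + KE z')) f(z') f₁(z)` for configurations with the same key and
the canonical densities `f, f₁` of the local Gibbs law and of the invariant law (off the hard-sphere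
domain the left side vanishes; on it `localGibbsProfile_eq_exp_mul` and `sum_le_of_cellKey_eq`). -/
theorem stub_binOscillation : ∀ (a₀ θ₀ : T3 → ℝ) (u₀ : T3 → V3), Continuous a₀ → Continuous θ₀ →
    Continuous u₀ → (∀ x, 0 < a₀ x) → (∀ x, 0 < θ₀ x) → ∀ η : ℝ, 0 < η → ∃ N₀ : ℕ, ∀ N : ℕ,
    N₀ ≤ N → ∀ σ : ℝ, ∀ z z' : Phase N, cellKey (rs N) (rs N) z = cellKey (rs N) (rs N) z' →
    canonicalDensity (Torus.geometry (Fin 3)) (hsDiameter σ N) (N + 1)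
          (localGibbsProfile a₀ u₀ θ₀) z *
        canonicalDensity (Torus.geometry (Fin 3)) (hsDiameter σ N) (N + 1)
          (localGibbsProfile (fun _ => 1) (fun _ => 0) (fun _ => 1)) z' ≤
      Real.exp (η * (((N : ℝ) + 1) + kinEnergy z + kinEnergy z')) *
        (canonicalDensity (Torus.geometry (Fin 3)) (hsDiameter σ N) (N + 1)
            (localGibbsProfile a₀ u₀ θ₀) z' *
          canonicalDensity (Torus.geometry (Fin 3)) (hsDiameter σ N) (N + 1)
            (localGibbsProfile (fun _ => 1) (fun _ => 0) (fun _ => 1)) z) := by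
  intro a₀ θ₀ u₀ ha hθ hu ha0 hθ0 η hη
  -- the coefficients of the one-body log-tilt `log (f_{a₀,u₀,θ₀} / f_{1,0,1})`
  set α : T3 → ℝ := fun x => Real.log (a₀ x) + Real.log (θ₀ x) * (-(Module.finrank ℝ V3 : ℝ) / 2) -
    ‖u₀ x‖ ^ 2 / (2 * θ₀ x) with hα_def
  set β : T3 → ℝ := fun x => 1 / 2 - 1 / (2 * θ₀ x) with hβ_def
  set γ : T3 → V3 := fun x => (θ₀ x)⁻¹ • u₀ x with hγ_def
  have hαc : Continuous α := by
    refine ((ha.log fun x => (ha0 x).ne').add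
      ((hθ.log fun x => (hθ0 x).ne').mul continuous_const)).sub ?_
    exact (hu.norm.pow 2).div (continuous_const.mul hθ) fun x => (mul_pos two_pos (hθ0 x)).ne'
  have hβc : Continuous β :=
    continuous_const.sub
      (continuous_const.div (continuous_const.mul hθ) fun x => (mul_pos two_pos (hθ0 x)).ne')
  have hγc : Continuous γ := (hθ.inv₀ fun x => (hθ0 x).ne').smul hu
  obtain ⟨N₀, hN₀⟩ := sum_le_of_cellKey_eq hαc hβc hγc hη
  refine ⟨N₀, fun N hN σ z z' hkey => ?_⟩
  set f := localGibbsProfile a₀ u₀ θ₀ with hf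
  set f₁ := localGibbsProfile (fun _ => (1 : ℝ)) (fun _ => (0 : V3)) (fun _ => (1 : ℝ)) with hf₁
  set S : Phase N → ℝ := fun w =>
    ∑ i, (α (w i).1 + β (w i).1 * ‖(w i).2‖ ^ 2 + ⟪γ (w i).1, (w i).2⟫_ℝ) with hS
  have hcore : S z ≤ η * (((N : ℝ) + 1) + kinEnergy z + kinEnergy z') + S z' := hN₀ N hN z z' hkey
  have hf0 : 0 ≤ f := fun y =>
    localGibbsProfile_nonneg (fun x => (ha0 x).le) (fun x => (hθ0 x).le) y
  have hf₁0 : 0 ≤ f₁ := fun y =>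
    localGibbsProfile_nonneg (fun _ => zero_le_one) (fun _ => zero_le_one) y
  -- the product profiles differ by the exponential of the tilt sum, on and off the domain
  have hT : tensorPow (N + 1) f = fun w => Real.exp (S w) * tensorPow (N + 1) f₁ w := by
    funext w
    simp only [tensorPow, hS]
    rw [Real.exp_sum, ← Finset.prod_mul_distrib]
    exact Finset.prod_congr rfl fun i _ => localGibbsProfile_eq_exp_mul ha0 hθ0 (w i)
  have hT' : ∀ w : Phase N,
      (hardSphereDomain (Torus.geometry (Fin 3)) (N + 1) (hsDiameter σ N)).indicator
          (tensorPow (N + 1) f) w =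
        Real.exp (S w) * (hardSphereDomain (Torus.geometry (Fin 3)) (N + 1)
          (hsDiameter σ N)).indicator (tensorPow (N + 1) f₁) w := fun w => by
    rw [hT]; exact indicator_mul_right _ (fun w => Real.exp (S w)) _
  have hJ : ∀ w : Phase N, 0 ≤ (hardSphereDomain (Torus.geometry (Fin 3)) (N + 1)
      (hsDiameter σ N)).indicator (tensorPow (N + 1) f₁) w := fun w =>
    indicator_nonneg (fun w _ => tensorPow_nonneg hf₁0 _ w) w
  have hZ : 0 ≤ (canonicalPartition (Torus.geometry (Fin 3)) (hsDiameter σ N) (N + 1) f)⁻¹ :=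
    inv_nonneg.2 (canonicalPartition_nonneg _ _ _ hf0)
  have hZ₁ : 0 ≤ (canonicalPartition (Torus.geometry (Fin 3)) (hsDiameter σ N) (N + 1) f₁)⁻¹ :=
    inv_nonneg.2 (canonicalPartition_nonneg _ _ _ hf₁0)
  have h1 : Real.exp (S z) ≤
      Real.exp (η * (((N : ℝ) + 1) + kinEnergy z + kinEnergy z')) * Real.exp (S z') := by
    rw [← Real.exp_add]
    exact Real.exp_le_exp.2 hcore
  simp only [canonicalDensity, hT']
  exact mul_mul_le_of_le hZ hZ₁ (hJ z) (hJ z') h1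

end Summit.AtomisticToContinuum.HydrodynamicLimit.Theorems.KickFairRelEquilibriumMesoLine

end
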